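import Mathlib
import Summits.QuantumFields.YangMills.Theorems.ComplexCouplingChannelContinuumLegGivenGapKLSepDictionary
import Summits.QuantumFields.YangMills.Theorems.ComplexCouplingChannelContinuumLegGivenGapStubNonnegSeparated
import HarnessLib

/-!
# Crux `ContinuumLegGivenGap` (stmt-QuantumFields-15828), line `duality-selection-nlo-skewness`: strict positivity of small bump pairs

Helper toward the registered stub `stub_KLSep_of` (lead c15, reshape c15-1; blueprint
`Cruxes/ContinuumLegGivenGap/Lines/duality-selection-KL-blueprint.md`, item (P3)). For OS data `T` with a non-trivial
species `s`, a family of real non-negative radial mass-one bumps `Φ r` (support radius `r`), the approximate-identity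
property of such families (registered `stub_approxIdentity`, taken as a hypothesis) and bump-pair positivity with its
Laplace dichotomy (registered `stub_bumpPairPositivity`, hypothesis; fed by `stub_rotationToAxis`, hypothesis): for any
two distinct points `a ≠ b` and any `r_max > 0` there is a radius `r ≤ r_max`, `2r < dist a b`, at which the truncated
two-point value of the pair `(Φ r (· − a), Φ r (· − b))` has STRICTLY positive real part (`exists_re_truncated_bumpPair_pos`).
Mechanism: otherwise the dichotomy kills every separated pair at radii `rₙ ↓ 0`, hence (dictionary
`inner_truncVec_truncVec`) every vacuum-subtracted bump vector `ψ_{Φ rₙ(·−b')}`, `b'⁰ > rₙ`; superposing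
(`apply_tensorFin_two_translationAverage_right`, `apply_tensorFin_one_translationAverage`) and letting `n → ∞`
(approximate identity) kills `⟪ψ_G, ψ_{G(·−ηe₀)}⟫`, which is `> 0` for the non-trivial `G` of `exists_truncVec_ne_zero`
(`re_inner_truncVec_translate_pos`). Everything is proved.
-/

noncomputable section

namespace Summit.QuantumFields.YangMills.Cruxes.ContinuumLegGivenGap.DualitySelectionNloSkewness

open scoped SchwartzMap InnerProductSpace ComplexConjugate
open Filter Topology MeasureTheory Set Metric
open Literature.MathematicalPhysics.QuantumFieldTheory Literature.MathematicalPhysics.QuantumLattice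
  Literature.MathematicalPhysics.AQFT Literature.Analysis.FunctionSpaces
open Summit.QuantumFields.YangMills.Theorems.CurvatureKernel

variable {ι : Type} {d : ℕ} [NeZero d]

/-! ### Small lemmas on radial real bumps -/

/-- For a real radial `φ`, `conj ∘ φ(· − b) ∘ θ = φ(· − θb)`. [folklore] -/
theorem starTest_thetaTest_compSubConstCLM_of_radial {φ : 𝓢(EuclideanSpace ℝ (Fin d), ℂ)}
    (hreal : ∀ x, (φ x).im = 0 ∧ 0 ≤ (φ x).re)
    (hrad : ∀ (L : EuclideanSpace ℝ (Fin d) ≃ₗᵢ[ℝ] EuclideanSpace ℝ (Fin d)) (x : EuclideanSpace ℝ (Fin d)),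
      φ (L x) = φ x)
    (b : EuclideanSpace ℝ (Fin d)) :
    starTest (thetaTest d (SchwartzMap.compSubConstCLM ℂ b φ)) =
      SchwartzMap.compSubConstCLM ℂ (timeReflection d b) φ := by
  ext y
  rw [starTest_thetaTest_apply, SchwartzMap.compSubConstCLM_apply, SchwartzMap.compSubConstCLM_apply]
  have h1 : timeReflection d y - b = timeReflection d (y - timeReflection d b) := by
    rw [map_sub, timeReflection_timeReflection]
  rw [h1, hrad, Complex.conj_eq_iff_im]
  exact (hreal _).1

/-- A bump supported in `closedBall 0 r` translated to `b` with `b⁰ > r` is positive-time. [folklore] -/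
theorem tsupport_compSubConstCLM_subset_pos_of_ball {φ : 𝓢(EuclideanSpace ℝ (Fin d), ℂ)} {r : ℝ}
    (hsupp : tsupport (φ : EuclideanSpace ℝ (Fin d) → ℂ) ⊆ closedBall 0 r) {b : EuclideanSpace ℝ (Fin d)}
    (hb : r < b 0) :
    tsupport ((SchwartzMap.compSubConstCLM ℂ b φ : 𝓢(EuclideanSpace ℝ (Fin d), ℂ)) :
      EuclideanSpace ℝ (Fin d) → ℂ) ⊆ {y | 0 < y 0} := by
  intro y hy
  have h := hsupp (sub_mem_tsupport_of_mem_tsupport_compSubConstCLM b φ hy)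
  rw [mem_closedBall_zero_iff] at h
  have h0 : ‖(y - b) 0‖ ≤ r := (PiLp.norm_apply_le (y - b) 0).trans h
  rw [PiLp.sub_apply, Real.norm_eq_abs] at h0
  simp only [mem_setOf_eq]
  have := (abs_le.1 h0).1
  linarith

/-- The time reflection of a point and the point are `2 b⁰` apart. [folklore] -/
theorem dist_timeReflection_self (b : EuclideanSpace ℝ (Fin d)) :
    dist (timeReflection d b) b = 2 * |b 0| := by
  rw [dist_eq_norm]
  have h : timeReflection d b - b = EuclideanSpace.single 0 (-2 * b 0) := by
    ext i
    by_cases hi : i = 0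
    · subst hi; simp [timeReflection_apply]; ring
    · simp [timeReflection_apply, hi]
  rw [h, PiLp.norm_single, Real.norm_eq_abs, abs_mul, abs_neg, abs_two]

/-! ### Vanishing of bump vectors under the dichotomy -/

variable {S : LabelledSchwingerFamily ι (EuclideanSpace ℝ (Fin d))}

/-- **The norm of a vacuum-subtracted bump vector is a mirror-pair two-point value**: for a real radial bump `φ`
supported in `closedBall 0 r` and `b⁰ > r`, `‖ψ_{φ(·−b)}‖² = Re W(θb, b)`. [folklore] -/
theorem re_inner_truncVec_bump_self (h : OSReconstructionNoE1 S) (h0 : S.IsNormalized) (s : ι)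
    {φ : 𝓢(EuclideanSpace ℝ (Fin d), ℂ)}
    (hreal : ∀ x, (φ x).im = 0 ∧ 0 ≤ (φ x).re)
    (hrad : ∀ (L : EuclideanSpace ℝ (Fin d) ≃ₗᵢ[ℝ] EuclideanSpace ℝ (Fin d)) (x : EuclideanSpace ℝ (Fin d)),
      φ (L x) = φ x)
    {b : EuclideanSpace ℝ (Fin d)}
    (hpos : tsupport ((SchwartzMap.compSubConstCLM ℂ b φ : 𝓢(EuclideanSpace ℝ (Fin d), ℂ)) :
      EuclideanSpace ℝ (Fin d) → ℂ) ⊆ {y | 0 < y 0}) :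
    ⟪h.fieldVec 1 (fun _ => s) (SchwartzMap.tensorFin 1 ![SchwartzMap.compSubConstCLM ℂ b φ])
          (isTimeOrdered_tensorFin_one hpos) -
        ⟪h.vacuum, h.fieldVec 1 (fun _ => s) (SchwartzMap.tensorFin 1 ![SchwartzMap.compSubConstCLM ℂ b φ])
          (isTimeOrdered_tensorFin_one hpos)⟫_ℂ • h.vacuum,
      h.fieldVec 1 (fun _ => s) (SchwartzMap.tensorFin 1 ![SchwartzMap.compSubConstCLM ℂ b φ])
          (isTimeOrdered_tensorFin_one hpos) -
        ⟪h.vacuum, h.fieldVec 1 (fun _ => s) (SchwartzMap.tensorFin 1 ![SchwartzMap.compSubConstCLM ℂ b φ])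
          (isTimeOrdered_tensorFin_one hpos)⟫_ℂ • h.vacuum⟫_ℂ =
      S 2 (fun _ => s) (SchwartzMap.tensorFin 2
          ![SchwartzMap.compSubConstCLM ℂ (timeReflection d b) φ, SchwartzMap.compSubConstCLM ℂ b φ]) -
        S 1 (fun _ => s) (SchwartzMap.tensorFin 1 ![SchwartzMap.compSubConstCLM ℂ (timeReflection d b) φ]) *
          S 1 (fun _ => s) (SchwartzMap.tensorFin 1 ![SchwartzMap.compSubConstCLM ℂ b φ]) := by
  rw [inner_truncVec_truncVec h h0 s hpos hpos, starTest_thetaTest_compSubConstCLM_of_radial hreal hrad b]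

/-- **Dichotomy ⇒ the bump vectors vanish**: if the truncated two-point value of EVERY `2r`-separated pair of
translates of the real radial bump `φ` (support radius `r`) vanishes, then `ψ_{φ(·−b)} = 0` for every `b⁰ > r`. [folklore] -/
theorem truncVec_bump_eq_zero (h : OSReconstructionNoE1 S) (h0 : S.IsNormalized) (s : ι)
    {φ : 𝓢(EuclideanSpace ℝ (Fin d), ℂ)} {r : ℝ}
    (hreal : ∀ x, (φ x).im = 0 ∧ 0 ≤ (φ x).re)
    (hrad : ∀ (L : EuclideanSpace ℝ (Fin d) ≃ₗᵢ[ℝ] EuclideanSpace ℝ (Fin d)) (x : EuclideanSpace ℝ (Fin d)),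
      φ (L x) = φ x)
    (hr : 0 ≤ r)
    (hvan : ∀ a' b' : EuclideanSpace ℝ (Fin d), 2 * r < dist a' b' →
      S 2 (fun _ => s) (SchwartzMap.tensorFin 2
          ![SchwartzMap.compSubConstCLM ℂ a' φ, SchwartzMap.compSubConstCLM ℂ b' φ]) -
        S 1 (fun _ => s) (SchwartzMap.tensorFin 1 ![SchwartzMap.compSubConstCLM ℂ a' φ]) *
          S 1 (fun _ => s) (SchwartzMap.tensorFin 1 ![SchwartzMap.compSubConstCLM ℂ b' φ]) = 0)
    {b : EuclideanSpace ℝ (Fin d)} (hb : r < b 0)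
    (hpos : tsupport ((SchwartzMap.compSubConstCLM ℂ b φ : 𝓢(EuclideanSpace ℝ (Fin d), ℂ)) :
      EuclideanSpace ℝ (Fin d) → ℂ) ⊆ {y | 0 < y 0}) :
    h.fieldVec 1 (fun _ => s) (SchwartzMap.tensorFin 1 ![SchwartzMap.compSubConstCLM ℂ b φ])
          (isTimeOrdered_tensorFin_one hpos) -
        ⟪h.vacuum, h.fieldVec 1 (fun _ => s) (SchwartzMap.tensorFin 1 ![SchwartzMap.compSubConstCLM ℂ b φ])
          (isTimeOrdered_tensorFin_one hpos)⟫_ℂ • h.vacuum = 0 := by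
  rw [← inner_self_eq_zero (𝕜 := ℂ), re_inner_truncVec_bump_self h h0 s hreal hrad hpos]
  refine hvan _ _ ?_
  rw [dist_timeReflection_self, abs_of_pos (lt_of_le_of_lt hr hb)]
  linarith

/-! ### Strict positivity of some small bump pair -/

/-- **Strict positivity of small bump pairs from non-triviality.** See the module docstring. The three displayed
hypotheses are, verbatim, the registered statements of `stub_rotationToAxis`, `stub_approxIdentity` and
`stub_bumpPairPositivity`. [folklore] -/
theorem exists_re_truncated_bumpPair_pos
    (hrot : ∀ (d : ℕ), 2 ≤ d → ∀ u v : EuclideanSpace ℝ (Fin d), ‖u‖ = ‖v‖ →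
      ∃ R : EuclideanSpace ℝ (Fin d) ≃ₗᵢ[ℝ] EuclideanSpace ℝ (Fin d),
        LinearMap.det (R.toLinearEquiv : EuclideanSpace ℝ (Fin d) →ₗ[ℝ] EuclideanSpace ℝ (Fin d)) = 1 ∧ R u = v)
    (happrox : ∀ (d : ℕ) (φ : ℕ → 𝓢(EuclideanSpace ℝ (Fin d), ℂ)) (r : ℕ → ℝ),
      (∀ n x, (φ n x).im = 0 ∧ 0 ≤ (φ n x).re) → (∀ n, ∫ x, φ n x = 1) →
      (∀ n, tsupport (φ n : EuclideanSpace ℝ (Fin d) → ℂ) ⊆ Metric.closedBall 0 (r n)) →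
      Tendsto r atTop (𝓝 0) →
      ∀ u : 𝓢(EuclideanSpace ℝ (Fin d), ℂ),
        Tendsto (fun n => Literature.Analysis.FunctionSpaces.SchwartzAverage.translationAverage
          (ContinuousLinearMap.id ℝ (EuclideanSpace ℝ (Fin d))) (φ n) u) atTop (𝓝 u))
    (hbump : ∀ (ι : Type) (d : ℕ) [NeZero d] (T : OSData ι d) (s : ι)
      (φ : 𝓢(EuclideanSpace ℝ (Fin d), ℂ)) (r : ℝ), 0 < r →
      (∀ x, (φ x).im = 0 ∧ 0 ≤ (φ x).re) →
      (∀ (L : EuclideanSpace ℝ (Fin d) ≃ₗᵢ[ℝ] EuclideanSpace ℝ (Fin d)) (x : EuclideanSpace ℝ (Fin d)), φ (L x) = φ x) →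
      tsupport (φ : EuclideanSpace ℝ (Fin d) → ℂ) ⊆ Metric.closedBall 0 r →
      (2 ≤ d → ∀ u v : EuclideanSpace ℝ (Fin d), ‖u‖ = ‖v‖ →
        ∃ R : EuclideanSpace ℝ (Fin d) ≃ₗᵢ[ℝ] EuclideanSpace ℝ (Fin d),
          LinearMap.det (R.toLinearEquiv : EuclideanSpace ℝ (Fin d) →ₗ[ℝ] EuclideanSpace ℝ (Fin d)) = 1 ∧ R u = v) →
      let W : EuclideanSpace ℝ (Fin d) → EuclideanSpace ℝ (Fin d) → ℂ := fun a b =>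
        T.schwinger 2 (fun _ => s) (SchwartzMap.tensorFin 2
            ![SchwartzMap.compSubConstCLM ℂ a φ, SchwartzMap.compSubConstCLM ℂ b φ]) -
          T.schwinger 1 (fun _ => s) (SchwartzMap.tensorFin 1 ![SchwartzMap.compSubConstCLM ℂ a φ]) *
            T.schwinger 1 (fun _ => s) (SchwartzMap.tensorFin 1 ![SchwartzMap.compSubConstCLM ℂ b φ])
      (∀ a b : EuclideanSpace ℝ (Fin d), 2 * r < dist a b → 0 ≤ (W a b).re ∧ (W a b).im = 0) ∧
      (∀ a b a' b' : EuclideanSpace ℝ (Fin d), 2 * r < dist a b → dist a b = dist a' b' → W a b = W a' b') ∧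
      ((∃ a b : EuclideanSpace ℝ (Fin d), 2 * r < dist a b ∧ (W a b).re = 0) →
        ∀ a b : EuclideanSpace ℝ (Fin d), 2 * r < dist a b → (W a b).re = 0))
    (T : OSData ι d) (s : ι) (hNT : T.IsNontrivial s)
    (Φ : ℝ → 𝓢(EuclideanSpace ℝ (Fin d), ℂ))
    (hΦre : ∀ r, 0 < r → ∀ x, (Φ r x).im = 0 ∧ 0 ≤ (Φ r x).re)
    (hΦrad : ∀ r, 0 < r → ∀ (L : EuclideanSpace ℝ (Fin d) ≃ₗᵢ[ℝ] EuclideanSpace ℝ (Fin d))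
      (x : EuclideanSpace ℝ (Fin d)), Φ r (L x) = Φ r x)
    (hΦsupp : ∀ r, 0 < r → tsupport (Φ r : EuclideanSpace ℝ (Fin d) → ℂ) ⊆ closedBall 0 r)
    (hΦmass : ∀ r, 0 < r → ∫ x, Φ r x = 1)
    {a b : EuclideanSpace ℝ (Fin d)} (hab : a ≠ b) {rmax : ℝ} (hrmax : 0 < rmax) :
    ∃ r : ℝ, 0 < r ∧ r ≤ rmax ∧ 2 * r < dist a b ∧
      0 < (T.schwinger 2 (fun _ => s) (SchwartzMap.tensorFin 2
            ![SchwartzMap.compSubConstCLM ℂ a (Φ r), SchwartzMap.compSubConstCLM ℂ b (Φ r)]) -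
          T.schwinger 1 (fun _ => s) (SchwartzMap.tensorFin 1 ![SchwartzMap.compSubConstCLM ℂ a (Φ r)]) *
            T.schwinger 1 (fun _ => s) (SchwartzMap.tensorFin 1 ![SchwartzMap.compSubConstCLM ℂ b (Φ r)])).re := by
  by_contra hcon
  push Not at hcon
  -- radii `rₙ ↓ 0`, all admissible
  have ht : 0 < dist a b := dist_pos.2 hab
  set ρ : ℝ := min rmax (dist a b / 3) with hρ
  have hρpos : 0 < ρ := lt_min hrmax (by positivity)
  have hρle : ρ ≤ rmax := min_le_left _ _
  have hρle' : ρ ≤ dist a b / 3 := min_le_right _ _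
  set rn : ℕ → ℝ := fun n => ρ / ((n : ℝ) + 2) with hrn
  have hrn_pos : ∀ n, 0 < rn n := fun n => by positivity
  have hrn_le_ρ : ∀ n, rn n ≤ ρ := fun n => by
    rw [hrn]
    exact div_le_self hρpos.le (by linarith [(Nat.cast_nonneg n : (0 : ℝ) ≤ n)])
  have hrn_le : ∀ n, rn n ≤ rmax := fun n => (hrn_le_ρ n).trans hρle
  have hrn_sep : ∀ n, 2 * rn n < dist a b := fun n => by linarith [hrn_le_ρ n]
  have hrn_lt : ∀ n, rn n < rmax + 1 := fun n => by linarith [hrn_le n]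
  have hrn_tendsto : Tendsto rn atTop (𝓝 0) := by
    have h1 : Tendsto (fun n : ℕ => ((n : ℝ) + 2)⁻¹) atTop (𝓝 0) := by
      have := tendsto_one_div_add_atTop_nhds_zero_nat (𝕜 := ℝ)
      have h2 : Tendsto (fun n : ℕ => 1 / ((n : ℝ) + 1)) atTop (𝓝 0) := this
      have h3 := h2.comp (tendsto_add_atTop_nat 1)
      refine h3.congr fun n => ?_
      simp only [Function.comp_apply, Nat.cast_add, Nat.cast_one, one_div]
      ring_nf
    have := h1.const_mul ρ
    rw [mul_zero] at this
    refine this.congr fun n => ?_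
    rw [hrn]; simp only; rw [div_eq_mul_inv]
  -- Step A: all separated pairs of `Φ (rₙ)` vanish
  have hvan : ∀ (n : ℕ) (a' b' : EuclideanSpace ℝ (Fin d)), 2 * rn n < dist a' b' →
      T.schwinger 2 (fun _ => s) (SchwartzMap.tensorFin 2
          ![SchwartzMap.compSubConstCLM ℂ a' (Φ (rn n)), SchwartzMap.compSubConstCLM ℂ b' (Φ (rn n))]) -
        T.schwinger 1 (fun _ => s) (SchwartzMap.tensorFin 1 ![SchwartzMap.compSubConstCLM ℂ a' (Φ (rn n))]) *
          T.schwinger 1 (fun _ => s) (SchwartzMap.tensorFin 1 ![SchwartzMap.compSubConstCLM ℂ b' (Φ (rn n))]) = 0 := by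
    intro n a' b' hsep
    obtain ⟨h1, -, h3⟩ := hbump ι d T s (Φ (rn n)) (rn n) (hrn_pos n) (hΦre _ (hrn_pos n))
      (hΦrad _ (hrn_pos n)) (hΦsupp _ (hrn_pos n)) (hrot d)
    have hz := le_antisymm (hcon (rn n) (hrn_pos n) (hrn_le n) (hrn_sep n)) (h1 a b (hrn_sep n)).1
    exact Complex.ext (h3 ⟨a, b, hrn_sep n, hz⟩ a' b' hsep) (h1 a' b' hsep).2
  -- the reconstruction and the non-trivial vector
  set h := OSReconstructionNoE1.of_osAxioms T.osAxioms with hh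
  obtain ⟨G₁, hG₁, hψG⟩ := exists_truncVec_ne_zero T s hNT
  set η : ℝ := rmax + 1 with hη
  have hηpos : 0 ≤ η := by positivity
  have hkey := re_inner_truncVec_translate_pos h s hG₁ hψG hηpos
  set Gη : 𝓢(EuclideanSpace ℝ (Fin d), ℂ) := SchwartzMap.compSubConstCLM ℂ (EuclideanSpace.single 0 η) G₁ with hGη
  have hGηpos : tsupport (Gη : EuclideanSpace ℝ (Fin d) → ℂ) ⊆ {y | 0 < y 0} :=
    tsupport_compSubConstCLM_subset_pos hG₁ (by simpa using hηpos)
  rw [inner_truncVec_truncVec h T.normalized s hG₁ hGηpos] at hkey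
  -- the functional `Λ v = 𝔖₂(u ⊗ v) − c 𝔖₁(v)`, `u = conj ∘ G ∘ θ`, `c = 𝔖₁(u)`
  set u : 𝓢(EuclideanSpace ℝ (Fin d), ℂ) := starTest (thetaTest d G₁) with hu
  set c : ℂ := T.schwinger 1 (fun _ => s) (SchwartzMap.tensorFin 1 ![u]) with hc
  obtain ⟨R, hR⟩ := exists_clm_tensorFin_two_right (E := EuclideanSpace ℝ (Fin d)) u
  obtain ⟨L₁, hL₁⟩ := exists_clm_tensorFin_one (E := EuclideanSpace ℝ (Fin d))
  have hΛcont : Continuous fun v : 𝓢(EuclideanSpace ℝ (Fin d), ℂ) =>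
      T.schwinger 2 (fun _ => s) (SchwartzMap.tensorFin 2 ![u, v]) -
        c * T.schwinger 1 (fun _ => s) (SchwartzMap.tensorFin 1 ![v]) := by
    simp_rw [← hR, ← hL₁]
    fun_prop
  -- approximate identity along `Φ (rₙ)`
  have hK := happrox d (fun n => Φ (rn n)) rn (fun n => hΦre _ (hrn_pos n)) (fun n => hΦmass _ (hrn_pos n))
    (fun n => hΦsupp _ (hrn_pos n)) hrn_tendsto Gη
  have hlim := (hΛcont.tendsto Gη).comp hK
  -- every term of the sequence vanishes
  have hzero : ∀ n : ℕ,
      T.schwinger 2 (fun _ => s) (SchwartzMap.tensorFin 2 ![u,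
          SchwartzAverage.translationAverage (ContinuousLinearMap.id ℝ (EuclideanSpace ℝ (Fin d))) (Φ (rn n)) Gη]) -
        c * T.schwinger 1 (fun _ => s) (SchwartzMap.tensorFin 1
          ![SchwartzAverage.translationAverage (ContinuousLinearMap.id ℝ (EuclideanSpace ℝ (Fin d))) (Φ (rn n)) Gη]) = 0 := by
    intro n
    rw [translationAverage_comm, apply_tensorFin_two_translationAverage_right,
      apply_tensorFin_one_translationAverage]
    have hpt : ∀ b' : EuclideanSpace ℝ (Fin d),
        Gη b' * T.schwinger 2 (fun _ => s) (SchwartzMap.tensorFin 2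
            ![u, SchwartzMap.compSubConstCLM ℂ b' (Φ (rn n))]) =
          c * (Gη b' * T.schwinger 1 (fun _ => s) (SchwartzMap.tensorFin 1
            ![SchwartzMap.compSubConstCLM ℂ b' (Φ (rn n))])) := by
      intro b'
      by_cases hb0 : Gη b' = 0
      · rw [hb0, zero_mul, zero_mul, mul_zero]
      · -- `b'` is charged: `b'⁰ > η > rₙ`, so the bump vector at `b'` vanishes
        have hb' : η < b' 0 := by
          have hmem : b' ∈ tsupport (Gη : EuclideanSpace ℝ (Fin d) → ℂ) := subset_tsupport _ hb0
          have := hG₁ (sub_mem_tsupport_of_mem_tsupport_compSubConstCLM (EuclideanSpace.single 0 η) G₁ hmem)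
          simpa [sub_pos] using this
        have hrb : rn n < b' 0 := (hrn_lt n).trans hb'
        have hbpos : tsupport ((SchwartzMap.compSubConstCLM ℂ b' (Φ (rn n)) : 𝓢(EuclideanSpace ℝ (Fin d), ℂ)) :
            EuclideanSpace ℝ (Fin d) → ℂ) ⊆ {y | 0 < y 0} :=
          tsupport_compSubConstCLM_subset_pos_of_ball (hΦsupp _ (hrn_pos n)) hrb
        have hΛb : T.schwinger 2 (fun _ => s) (SchwartzMap.tensorFin 2
              ![u, SchwartzMap.compSubConstCLM ℂ b' (Φ (rn n))]) -
            c * T.schwinger 1 (fun _ => s) (SchwartzMap.tensorFin 1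
              ![SchwartzMap.compSubConstCLM ℂ b' (Φ (rn n))]) = 0 := by
          rw [hc, hu, ← inner_truncVec_truncVec h T.normalized s hG₁ hbpos,
            truncVec_bump_eq_zero h T.normalized s (hΦre _ (hrn_pos n)) (hΦrad _ (hrn_pos n))
              (hrn_pos n).le (hvan n) hrb hbpos, inner_zero_right]
        linear_combination (Gη b') * hΛb
    simp_rw [hpt]
    rw [integral_const_mul, sub_self]
  have hΛ0 : T.schwinger 2 (fun _ => s) (SchwartzMap.tensorFin 2 ![u, Gη]) -
      c * T.schwinger 1 (fun _ => s) (SchwartzMap.tensorFin 1 ![Gη]) = 0 := by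
    refine tendsto_nhds_unique hlim ?_
    have : (fun n => (fun v : 𝓢(EuclideanSpace ℝ (Fin d), ℂ) =>
        T.schwinger 2 (fun _ => s) (SchwartzMap.tensorFin 2 ![u, v]) -
          c * T.schwinger 1 (fun _ => s) (SchwartzMap.tensorFin 1 ![v]))
        (SchwartzAverage.translationAverage (ContinuousLinearMap.id ℝ (EuclideanSpace ℝ (Fin d))) (Φ (rn n)) Gη)) =
        fun _ => (0 : ℂ) := funext hzero
    rw [Function.comp_def, this]
    exact tendsto_const_nhds
  rw [hc, hu] at hΛ0
  rw [hΛ0, Complex.zero_re] at hkey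
  exact lt_irrefl _ hkey

end Summit.QuantumFields.YangMills.Cruxes.ContinuumLegGivenGap.DualitySelectionNloSkewness

end
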